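import Literature.NumberTheory.Connes2026.SemilocalCutoffConjugation
import HarnessLib

/-!
# Connes 1999 Thm VII.4, `k = ℚ`, `S = {∞} ∪ P` — THE ANNULUS CORRECTION AS A GEOMETRIC SERIES OF DILATED
# CUTOFFS: `P̂⁰_L ϑ(e^τ) = ϑ(e^τ) P̂⁰_{Le^τ}`, `1 − θ_p = p^{−1/2}ϑ(p)`, `D_p = p^{−1/2}ϑ(p⁻¹)`, and
# `u_p^*(1 − θ_p) = Σ_j ((1−θ_p)^{j+1} − p⁻¹(1−θ_p)^j)`

LABEL (line 1): RH-FREE literature (theorems only; NO definition, NO named fact).  bears_on: LADDER-RH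
W-C/W-P (C1 named-fact debt), cell `rh-crit`, sub-cell cc, overflow row O1 — green layer under the row's last
named fact `Connes1999_thm_VII_4_rat` (the cases `P ≠ ∅`), fourth file of the "annulus road"
(`SemilocalCutoffConjugation`, `AnnulusScalingSupport`, `SemilocalCutoffTraceReduction`).  WHAT THIS IS NOT:
any claim about positivity, Weil's criterion or RH — operator algebra of dilations and cutoffs; nothing here
bears on the truth of RH.

Sources.  A. Connes, Selecta Math. 5 (1999) [`Connes1999`], §VII (12)–(13), §V (15)–(16) (the cutoffs and
their behaviour under the scaling group), Thm VII.4 (held text `paper:arxiv-math_9811068`, p0013); A. Connes,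
C. Consani, Selecta Math. 27 (2021) 77 [`ConnesConsani2021`], §4 eq. (40) (`ϑ(λ)`); A. Connes, C. Consani,
H. Moscovici, Ann. Funct. Anal. 15 (2024) [`ConnesConsaniMoscovici2024`], §4.2 (44)–(46) (`η_p = Σ D_p^k`),
§4.6–4.7 (`θ_p`).

## What is proved

With `ϑ(e^τ) = scalingUnitary τ`, `P_Λ = cutoffProj Λ`, `P̂⁰_L = dualCutoffProj ∅ L = 𝓕 P_L 𝓕⁻¹`,
`θ_p = primeTwist p`, `D_p = primeDilation p`, `η_p = semilocalEta p`, `u_p = twistUnitary {p}`: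

* `fourierL2Inv_mul_scalingUnitary` (`𝓕⁻¹ ϑ(e^τ) = ϑ(e^{−τ}) 𝓕⁻¹`) and **`dualCutoffProj_empty_mul_scalingUnitary`**:
  `P̂⁰_L ϑ(e^τ) = ϑ(e^τ) P̂⁰_{Le^{τ}}` — the ultraviolet cutoff moves OPPOSITE to the infrared one
  (`P_Λ ϑ(e^τ) = ϑ(e^τ) P_{Λe^{−τ}}`, first file), so that the product of the two cutoff scales is invariant;
* `scalingUnitary_natCast_mul` (`ϑ(e^{nτ}) = ϑ(e^τ)^n`);
* **`one_sub_primeTwist_eq_smul_scalingUnitary`** (`1 − θ_p = p^{−1/2} ϑ(p)`, i.e. `T = p⁻¹D_{p⁻¹}` is the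
  unitary dilation by `p` scaled by `p^{−1/2}`) and **`primeDilation_eq_smul_scalingUnitary`**
  (`D_p = p^{−1/2} ϑ(p⁻¹)`), with their powers `one_sub_primeTwist_pow`, `primeDilation_pow_eq_smul`;
* `primeDilation_mul_one_sub_primeTwist` (`D_p (1 − θ_p) = p⁻¹`), `hasSum_twistProdUnit_singleton_inv`
  (`θ_p⁻¹ = Σ_j (1 − θ_p)^j`, `twistProdUnit_singleton`), and **`hasSum_adjoint_twistUnitary_mul_one_sub_primeTwist`**:
  `u_p^* (1 − θ_p) = Σ_{j ≥ 0} ((1 − θ_p)^{j+1} − p⁻¹ (1 − θ_p)^j)` (operator-norm convergent) — together with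
  the tree's `hasSum_semilocalEta` (`η_p = Σ_k D_p^k`) this expands both correction terms of the annulus identity
  `u_p^* P_Λ u_p = P_Λ + u_p^*(1−θ_p) Q₀ η_p + Q₀ D_p η_p` into geometric series of `ϑ(p^{±j}) Q₀ ϑ(p^{∓k})`-terms
  with weights `O(p^{−(j+k)/2})`.

No instance, notation or attribute; no `def`.
-/

noncomputable section

open _root_.MeasureTheory Complex Set Filter
open scoped Real Topology ComplexConjugate ENNReal InnerProductSpace

namespace Literature.NumberTheory.Connes2026

open Literature.NumberTheory.LFunctions Literature.Analysis.OperatorTheory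
open Literature.NumberTheory.ConnesConsani2024
open Literature.NumberTheory.ConnesConsani2021

/-! ## §1. The ultraviolet cutoff under the scaling group -/

section DualCutoff

/-- Changing the scale parameter of `lpDilation` along an equality of reals. [folklore] -/
private theorem lpDilation_congr {a b : ℝ} (h : a = b) (ha : a ≠ 0) (hb : b ≠ 0) :
    (lpDilation (V := ℝ) (F := ℂ) (p := (2 : ℝ≥0∞)) a ha ENNReal.ofNat_ne_top :
        Lp ℂ 2 (volume : Measure ℝ) →L[ℂ] Lp ℂ 2 (volume : Measure ℝ)) =
      lpDilation (V := ℝ) (F := ℂ) (p := (2 : ℝ≥0∞)) b hb ENNReal.ofNat_ne_top := by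
  subst h
  rfl

/-- **`𝓕⁻¹ ϑ(e^τ) = ϑ(e^{−τ}) 𝓕⁻¹`.** [cite: ConnesConsaniMoscovici2024, Prop. 4.2 (ii) §4.2 p. 18 ("`𝔽_S ϑ(λ) = ϑ(λ⁻¹) 𝔽_S`", arXiv chunk p0013:L5)] -/
theorem fourierL2Inv_mul_scalingUnitary (τ : ℝ) :
    fourierL2Inv * scalingUnitary τ = scalingUnitary (-τ) * fourierL2Inv := by
  have h := fourierL2_mul_scalingUnitary (-τ)
  rw [neg_neg] at h
  -- `𝓕 ϑ(−τ) = ϑ(τ) 𝓕`; conjugate by `𝓕⁻¹`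
  calc fourierL2Inv * scalingUnitary τ
      = fourierL2Inv * scalingUnitary τ * (fourierL2 * fourierL2Inv) := by rw [fourierL2_mul_fourierL2Inv, mul_one]
    _ = fourierL2Inv * (scalingUnitary τ * fourierL2) * fourierL2Inv := by simp only [mul_assoc]
    _ = fourierL2Inv * (fourierL2 * scalingUnitary (-τ)) * fourierL2Inv := by rw [h]
    _ = (fourierL2Inv * fourierL2) * scalingUnitary (-τ) * fourierL2Inv := by simp only [mul_assoc]
    _ = scalingUnitary (-τ) * fourierL2Inv := by rw [fourierL2Inv_mul_fourierL2, one_mul]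

/-- **`P̂⁰_L ϑ(e^τ) = ϑ(e^τ) P̂⁰_{Le^{τ}}`** — the ultraviolet cutoff scales oppositely to `P_Λ ϑ(e^τ) = ϑ(e^τ) P_{Λe^{−τ}}`
(Connes 1999 §V: the cutoff region `{|x| ≤ Λ, |ξ| ≤ Λ}` has scale-invariant volume). [cite: Connes1999, §V eqs. (15)–(16) and §VII eq. (13), proof of Thm 4 eq. (29) (arXiv p0013)] -/
theorem dualCutoffProj_empty_mul_scalingUnitary (L τ : ℝ) :
    dualCutoffProj ∅ L * scalingUnitary τ = scalingUnitary τ * dualCutoffProj ∅ (L * Real.exp τ) := by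
  have h1 := cutoffProj_mul_scalingUnitary L (-τ)
  rw [neg_neg] at h1
  have h2 := fourierL2_mul_scalingUnitary (-τ)
  rw [neg_neg] at h2
  rw [dualCutoffProj_empty, dualCutoffProj_empty]
  calc fourierL2 * cutoffProj L * fourierL2Inv * scalingUnitary τ
      = fourierL2 * cutoffProj L * (fourierL2Inv * scalingUnitary τ) := by simp only [mul_assoc]
    _ = fourierL2 * (cutoffProj L * scalingUnitary (-τ)) * fourierL2Inv := by
        rw [fourierL2Inv_mul_scalingUnitary]; simp only [mul_assoc]
    _ = (fourierL2 * scalingUnitary (-τ)) * cutoffProj (L * Real.exp τ) * fourierL2Inv := by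
        rw [h1]; simp only [mul_assoc]
    _ = scalingUnitary τ * (fourierL2 * cutoffProj (L * Real.exp τ) * fourierL2Inv) := by
        rw [h2]; simp only [mul_assoc]

/-- `ϑ(e^{nτ}) = ϑ(e^τ)^n` (the scaling group law). [cite: ConnesConsani2021, §4 eq. (40) p. 15] -/
theorem scalingUnitary_natCast_mul (n : ℕ) (τ : ℝ) : scalingUnitary (n * τ) = scalingUnitary τ ^ n := by
  induction n with
  | zero => simp [scalingUnitary_zero]
  | succ n ih =>
    rw [Nat.cast_succ, add_mul, one_mul, scalingUnitary_add, ih, pow_succ]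
    rfl

end DualCutoff

/-! ## §2. `1 − θ_p` and `D_p` as scaled unitary dilations -/

section PrimeDilations

variable (p : ℕ) [hp : Fact p.Prime]

/-- Unfolding `scalingUnitary` at `τ = log p` with the dilation parameter rewritten to `p⁻¹`. [folklore] -/
private theorem scalingUnitary_log_eq (p : ℕ) [hp : Fact p.Prime] (hexp : Real.exp (-Real.log p) = (p : ℝ)⁻¹) :
    scalingUnitary (Real.log p) = (Real.exp (-Real.log p / 2) : ℂ) •
      lpDilation (V := ℝ) (F := ℂ) (p := (2 : ℝ≥0∞)) ((p : ℝ)⁻¹)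
        (inv_ne_zero (Nat.cast_ne_zero.mpr hp.out.ne_zero)) ENNReal.ofNat_ne_top := by
  unfold scalingUnitary
  rw [lpDilation_congr hexp]

/-- **`1 − θ_p = p^{−1/2} ϑ(p)`**: the operator `T = p⁻¹ D_{p⁻¹}` of the annulus identity is `p^{−1/2}` times
the unitary dilation `ϑ(e^{log p})`. [cite: ConnesConsaniMoscovici2024, §4.6 Lemma after Def. 4.5 (ii) p. 22 (arXiv chunk p0015:L1–L15: `g(λ) − p^{−1/2}g(λ/p)`)] -/
theorem one_sub_primeTwist_eq_smul_scalingUnitary :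
    (1 : Lp ℂ 2 (volume : Measure ℝ) →L[ℂ] Lp ℂ 2 (volume : Measure ℝ)) - primeTwist p =
      (((Real.sqrt p)⁻¹ : ℝ) : ℂ) • scalingUnitary (Real.log p) := by
  have hp0 : (0 : ℝ) < p := by exact_mod_cast hp.out.pos
  have hpne : (p : ℝ) ≠ 0 := hp0.ne'
  have hexp : Real.exp (-Real.log p) = (p : ℝ)⁻¹ := by rw [Real.exp_neg, Real.exp_log hp0]
  have hexp2 : Real.exp (-Real.log p / 2) = (Real.sqrt p)⁻¹ := by
    rw [show -Real.log p / 2 = -(Real.log p / 2) by ring, Real.exp_neg, ← Real.log_sqrt hp0.le,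
      Real.exp_log (Real.sqrt_pos.mpr hp0)]
  rw [primeTwist_eq_one_sub, sub_sub_cancel, scalingUnitary_log_eq p hexp, hexp2, smul_smul,
    ← Complex.ofReal_mul, ← mul_inv, Real.mul_self_sqrt hp0.le, Complex.ofReal_inv, Complex.ofReal_natCast]

/-- **`D_p = p^{−1/2} ϑ(p⁻¹)`**: the dilation `D_p f = f(p ·)` is `p^{−1/2}` times the unitary `ϑ(e^{−log p})`. [cite: ConnesConsaniMoscovici2024, §4.2 eq. (44) p. 16 and proof of Thm. 4.1 (ii) ("`‖D_p f‖ = p^{−1/2}‖f‖`", arXiv chunk p0013:L52)] -/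
theorem primeDilation_eq_smul_scalingUnitary :
    primeDilation p = (((Real.sqrt p)⁻¹ : ℝ) : ℂ) • scalingUnitary (-Real.log p) := by
  have hp0 : (0 : ℝ) < p := by exact_mod_cast hp.out.pos
  have hexp : Real.exp (-(-Real.log p)) = (p : ℝ) := by rw [neg_neg, Real.exp_log hp0]
  have hexp2 : Real.exp (-(-Real.log p) / 2) = Real.sqrt p := by
    rw [neg_neg, ← Real.log_sqrt hp0.le, Real.exp_log (Real.sqrt_pos.mpr hp0)]
  have h1 : scalingUnitary (-Real.log p) = (Real.exp (-(-Real.log p) / 2) : ℂ) • primeDilation p := by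
    unfold scalingUnitary
    rw [primeDilation_eq_lpDilation, lpDilation_congr hexp]
  rw [h1, hexp2, smul_smul, ← Complex.ofReal_mul, inv_mul_cancel₀ (Real.sqrt_pos.mpr hp0).ne',
    Complex.ofReal_one, one_smul]

/-- `(1 − θ_p)^j = p^{−j/2} ϑ(p^j)`. [cite: ConnesConsaniMoscovici2024, §4.6 Lemma after Def. 4.5 (ii) p. 22 (arXiv chunk p0015:L1–L15)] -/
theorem one_sub_primeTwist_pow (j : ℕ) :
    ((1 : Lp ℂ 2 (volume : Measure ℝ) →L[ℂ] Lp ℂ 2 (volume : Measure ℝ)) - primeTwist p) ^ j =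
      ((((Real.sqrt p)⁻¹ : ℝ) : ℂ) ^ j) • scalingUnitary (j * Real.log p) := by
  rw [one_sub_primeTwist_eq_smul_scalingUnitary, smul_pow, scalingUnitary_natCast_mul]

/-- `D_p^k = p^{−k/2} ϑ(p^{−k})`. [cite: ConnesConsaniMoscovici2024, §4.2 eq. (44) p. 16 (arXiv chunk p0012:L74: `Σ f(p^k u)`)] -/
theorem primeDilation_pow_eq_smul (k : ℕ) :
    primeDilation p ^ k = ((((Real.sqrt p)⁻¹ : ℝ) : ℂ) ^ k) • scalingUnitary (k * (-Real.log p)) := by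
  rw [primeDilation_eq_smul_scalingUnitary, smul_pow, scalingUnitary_natCast_mul]

/-- **`D_p (1 − θ_p) = p⁻¹`** (`(p⁻¹ D_{p⁻¹} f)(p v)`-composition: `D_p D_{p⁻¹} = 1`). [cite: ConnesConsaniMoscovici2024, §4.6 Lemma after Def. 4.5 (ii) p. 22 (arXiv chunk p0015:L1–L15)] -/
theorem primeDilation_mul_one_sub_primeTwist :
    primeDilation p * ((1 : Lp ℂ 2 (volume : Measure ℝ) →L[ℂ] Lp ℂ 2 (volume : Measure ℝ)) - primeTwist p) =
      ((p : ℂ)⁻¹) • (1 : Lp ℂ 2 (volume : Measure ℝ) →L[ℂ] Lp ℂ 2 (volume : Measure ℝ)) := by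
  have hpne : (p : ℝ) ≠ 0 := Nat.cast_ne_zero.mpr hp.out.ne_zero
  rw [primeTwist_eq_one_sub, sub_sub_cancel, mul_smul_comm, primeDilation_eq_lpDilation, lpDilation_mul,
    lpDilation_congr (inv_mul_cancel₀ hpne) _ one_ne_zero, lpDilation_one]

/-- The unit `twistProdUnit {p}` is the tree's `primeTwistUnit p`. [cite: ConnesConsaniMoscovici2024, Thm. 4.6 §4.7 p. 22] -/
theorem twistProdUnit_singleton : twistProdUnit {p} = primeTwistUnit p :=
  Units.ext (by rw [val_twistProdUnit, twistProd_singleton, val_primeTwistUnit])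

/-- **`θ_p⁻¹ = Σ_j (1 − θ_p)^j`** (Neumann series, `‖1 − θ_p‖ = p^{−1/2} < 1`). [cite: ConnesConsaniMoscovici2024, Thm. 4.6 §4.7 p. 22 (arXiv chunk p0015:L88: `θ_S` has a bounded inverse)] -/
theorem hasSum_twistProdUnit_singleton_inv :
    HasSum (fun j : ℕ => ((1 : Lp ℂ 2 (volume : Measure ℝ) →L[ℂ] Lp ℂ 2 (volume : Measure ℝ)) - primeTwist p) ^ j)
      (↑(twistProdUnit {p})⁻¹ : Lp ℂ 2 (volume : Measure ℝ) →L[ℂ] Lp ℂ 2 (volume : Measure ℝ)) := by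
  rw [twistProdUnit_singleton]
  have h := (summable_geometric_of_norm_lt_one (norm_one_sub_primeTwist_lt_one p)).hasSum
  have hinv : (↑(primeTwistUnit p)⁻¹ : Lp ℂ 2 (volume : Measure ℝ) →L[ℂ] Lp ℂ 2 (volume : Measure ℝ)) =
      ∑' b : ℕ, ((1 : Lp ℂ 2 (volume : Measure ℝ) →L[ℂ] Lp ℂ 2 (volume : Measure ℝ)) - primeTwist p) ^ b := rfl
  rw [hinv]
  exact h

/-- **The first correction operator as a geometric series**:
`u_p^* (1 − θ_p) = Σ_{j≥0} ((1 − θ_p)^{j+1} − p⁻¹ (1 − θ_p)^j)` in operator norm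
(`u_p^* = θ_p⁻¹ η_p⁻¹ = (Σ_j (1−θ_p)^j)(1 − D_p)` and `D_p(1 − θ_p) = p⁻¹`).  With `(1−θ_p)^j = p^{−j/2}ϑ(p^j)`
the coefficients are `p^{−(j+1)/2} − p^{−1−j/2} = O(p^{−j/2})`. [cite: Connes1999, §VII proof of Thm 4 eqs. (30)–(32) (arXiv p0013); ConnesConsaniMoscovici2024, §4.2 eq. (44), §4.7 p. 22] -/
theorem hasSum_adjoint_twistUnitary_mul_one_sub_primeTwist :
    HasSum (fun j : ℕ =>
        ((1 : Lp ℂ 2 (volume : Measure ℝ) →L[ℂ] Lp ℂ 2 (volume : Measure ℝ)) - primeTwist p) ^ (j + 1) -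
          ((p : ℂ)⁻¹) • ((1 : Lp ℂ 2 (volume : Measure ℝ) →L[ℂ] Lp ℂ 2 (volume : Measure ℝ)) - primeTwist p) ^ j)
      (ContinuousLinearMap.adjoint (twistUnitary {p}) *
        ((1 : Lp ℂ 2 (volume : Measure ℝ) →L[ℂ] Lp ℂ 2 (volume : Measure ℝ)) - primeTwist p)) := by
  set T : Lp ℂ 2 (volume : Measure ℝ) →L[ℂ] Lp ℂ 2 (volume : Measure ℝ) := 1 - primeTwist p with hT
  have hηinv : etaInvProd {p} = 1 - primeDilation p := by
    have : etaInvProd {p} = etaInvAt p := by simp [etaInvProd]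
    rw [this, etaInvAt_of_prime]
  -- `u^* T = θ⁻¹ (1 − D_p) T = θ⁻¹ (T − p⁻¹)`
  have hfac : ContinuousLinearMap.adjoint (twistUnitary {p}) * T =
      (↑(twistProdUnit {p})⁻¹ : Lp ℂ 2 (volume : Measure ℝ) →L[ℂ] Lp ℂ 2 (volume : Measure ℝ)) *
        (T - ((p : ℂ)⁻¹) • 1) := by
    rw [adjoint_twistUnitary, hηinv, mul_assoc, sub_mul, one_mul, hT, primeDilation_mul_one_sub_primeTwist]
  rw [hfac]
  have hgeo := (hasSum_twistProdUnit_singleton_inv p).mul_right (T - ((p : ℂ)⁻¹) • 1)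
  refine hgeo.congr_fun fun j => ?_
  rw [hT, mul_sub, ← pow_succ, mul_smul_comm, mul_one]

end PrimeDilations

end Literature.NumberTheory.Connes2026
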